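import Summits.ValiantsHypothesis.ValiantsHypothesis.Theorems.KPlusLogSqLawTropicalBSymmetryGroup

/-!
# Route `KPlusLogSqLaw`, crux `TropicalB` — TORUS-symmetric designs have at most `m·K` dominant terms

HONEST FRAMING.  Helper toward the registered stubs `stub_tropThin` / `stub_tropFat` of
`Cruxes/TropicalB/Lines/birth.lean` (crux `Summit.ValiantsHypothesis.ValiantsHypothesis.Theses.KPlusLogSqLaw.TropicalB`,
ledger item `stmt-ValiantsHypothesis-19771`, route `KPlusLogSqLaw`; cell `pub-symmetroid`, seat `val-sym-trop-p3`,
2026-08-26).  A concrete instance of `…TropicalBSymmetryGroup.chain_succ_le_of_transitiveSymmetry` (this seat): the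
«torus register» of val-sym-trop-p2's register census (HOME/val-sym-trop-p2/REGISTERS.md, R2) as a kernel corollary.
OBJECT-SYMMETRY sector (measure zero among designs); nothing here bounds `TropicalB` for general designs, and nothing
bears on `KPlusLogSqLaw`, `MatrixDescartes` or `VP ≠ VNP`.

Index the `m₁·m₂` rows and columns by the torus `Fin m₁ × Fin m₂` through `finProdFinEquiv`, and let `T₁`, `T₂` be the
two translations (by one step in the first, resp. second, coordinate).  If a design is invariant under translating rows
and columns simultaneously by `T₁` and by `T₂`, the group generated acts transitively on the columns, so

* `torus_chain_succ_le` : every sign-alternating dominant chain has `n + 1 ≤ (m₁·m₂)·K` — the two torus «phases» multiply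
  to `m₁·m₂ = m` dominant permutations at most, never `m²`;
* `torus_kPlusLogSq` : the crux's inequality with `C = 2` on this class.
[folklore]
-/

set_option linter.dupNamespace false
set_option autoImplicit false

namespace Summit.ValiantsHypothesis.ValiantsHypothesis.Theorems.KPlusLogSqLaw

open Summit.ValiantsHypothesis.ValiantsHypothesis.Theorems.MatrixDescartes.Negative
open Summit.ValiantsHypothesis.ValiantsHypothesis.Theorems.LacunarySymmetroidMatrixDescartes
open Summit.ValiantsHypothesis.ValiantsHypothesis.Theorems.LacunarySymmetroidMatrixDescartes.TropicalCensus
open scoped BigOperators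
open Finset

section Torus

variable {m₁ m₂ K : ℕ}

/-- powers of the first torus translation act on the first coordinate. [folklore] -/
theorem torusFst_pow_apply (j : ℕ) : ∀ (x : Fin m₁) (y : Fin m₂),
    ((finProdFinEquiv.permCongr (Equiv.prodCongr (finRotate m₁) (Equiv.refl (Fin m₂)))) ^ j)
      (finProdFinEquiv (x, y)) = finProdFinEquiv (((finRotate m₁) ^ j) x, y) := by
  induction j with
  | zero => intro x y; simp
  | succ j ih =>
    intro x y
    rw [pow_succ', Equiv.Perm.mul_apply, ih, Equiv.permCongr_apply, Equiv.symm_apply_apply,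
      Equiv.prodCongr_apply, pow_succ', Equiv.Perm.mul_apply]
    rfl

/-- powers of the second torus translation act on the second coordinate. [folklore] -/
theorem torusSnd_pow_apply (j : ℕ) : ∀ (x : Fin m₁) (y : Fin m₂),
    ((finProdFinEquiv.permCongr (Equiv.prodCongr (Equiv.refl (Fin m₁)) (finRotate m₂))) ^ j)
      (finProdFinEquiv (x, y)) = finProdFinEquiv (x, ((finRotate m₂) ^ j) y) := by
  induction j with
  | zero => intro x y; simp
  | succ j ih =>
    intro x y
    rw [pow_succ', Equiv.Perm.mul_apply, ih, Equiv.permCongr_apply, Equiv.symm_apply_apply,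
      Equiv.prodCongr_apply, pow_succ', Equiv.Perm.mul_apply]
    rfl

/-- `(finRotate m)^j` moves `0` to `j` (`j < m`). [folklore] -/
theorem finRotate_pow_zero (m j : ℕ) (hj : j < m) :
    ((finRotate m) ^ j) ⟨0, lt_of_le_of_lt (Nat.zero_le j) hj⟩ = ⟨j, hj⟩ := by
  have h := finRotate_pow_apply_of_lt (m := m) j ⟨0, lt_of_le_of_lt (Nat.zero_le j) hj⟩ (by simp only; omega)
  rw [h]
  apply Fin.ext
  simp

/-- **Torus-symmetric designs: `n + 1 ≤ (m₁·m₂)·K`.**  If a design on `Fin (m₁·m₂)` (rows and columns indexed by the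
torus `Fin m₁ × Fin m₂` via `finProdFinEquiv`) is invariant under the simultaneous translations of rows and columns by one
step in either coordinate, every sign-alternating dominant chain has at most `(m₁·m₂)·K` terms. [folklore] -/
theorem torus_chain_succ_le (hm₁ : 0 < m₁) (hm₂ : 0 < m₂) (d : Fin K → ℕ)
    (v ε : Fin (m₁ * m₂) → Fin (m₁ * m₂) → Fin K → ℤ)
    (hv₁ : ∀ a b l, v ((finProdFinEquiv.permCongr (Equiv.prodCongr (finRotate m₁) (Equiv.refl (Fin m₂)))) a)
      ((finProdFinEquiv.permCongr (Equiv.prodCongr (finRotate m₁) (Equiv.refl (Fin m₂)))) b) l = v a b l)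
    (hε₁ : ∀ a b l, ε ((finProdFinEquiv.permCongr (Equiv.prodCongr (finRotate m₁) (Equiv.refl (Fin m₂)))) a)
      ((finProdFinEquiv.permCongr (Equiv.prodCongr (finRotate m₁) (Equiv.refl (Fin m₂)))) b) l = ε a b l)
    (hv₂ : ∀ a b l, v ((finProdFinEquiv.permCongr (Equiv.prodCongr (Equiv.refl (Fin m₁)) (finRotate m₂))) a)
      ((finProdFinEquiv.permCongr (Equiv.prodCongr (Equiv.refl (Fin m₁)) (finRotate m₂))) b) l = v a b l)
    (hε₂ : ∀ a b l, ε ((finProdFinEquiv.permCongr (Equiv.prodCongr (Equiv.refl (Fin m₁)) (finRotate m₂))) a)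
      ((finProdFinEquiv.permCongr (Equiv.prodCongr (Equiv.refl (Fin m₁)) (finRotate m₂))) b) l = ε a b l)
    {n : ℕ} (θ : Fin (n + 1) → ℤ) (p : Fin (n + 1) → Equiv.Perm (Fin (m₁ * m₂)) × (Fin (m₁ * m₂) → Fin K))
    (hθ : StrictMono θ) (hdom : ∀ k, IsDominant d v ε (θ k) (p k))
    (halt : ∀ k : Fin n, termSign ε (p k.castSucc) * termSign ε (p k.succ) < 0) :
    n + 1 ≤ (m₁ * m₂) * K := by
  classical
  set T₁ : Equiv.Perm (Fin (m₁ * m₂)) :=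
    finProdFinEquiv.permCongr (Equiv.prodCongr (finRotate m₁) (Equiv.refl (Fin m₂))) with hT₁
  set T₂ : Equiv.Perm (Fin (m₁ * m₂)) :=
    finProdFinEquiv.permCongr (Equiv.prodCongr (Equiv.refl (Fin m₁)) (finRotate m₂)) with hT₂
  set gens : Set (Equiv.Perm (Fin (m₁ * m₂)) × Equiv.Perm (Fin (m₁ * m₂))) := {(T₁, T₁), (T₂, T₂)} with hgens
  have hgen : ∀ g ∈ gens, (∀ a b l, v (g.1 a) (g.2 b) l = v a b l) ∧ (∀ a b l, ε (g.1 a) (g.2 b) l = ε a b l) := by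
    intro g hg
    rcases hg with rfl | hg
    · exact ⟨hv₁, hε₁⟩
    · rw [Set.mem_singleton_iff] at hg
      subst hg
      exact ⟨hv₂, hε₂⟩
  set t₀ : Fin (m₁ * m₂) := finProdFinEquiv (⟨0, hm₁⟩, ⟨0, hm₂⟩) with ht₀
  have htrans : ∀ b : Fin (m₁ * m₂), ∃ g ∈ Subgroup.closure gens, g.2 t₀ = b := by
    intro b
    obtain ⟨⟨i, j⟩, rfl⟩ := finProdFinEquiv.surjective b
    refine ⟨(T₁, T₁) ^ (i : ℕ) * (T₂, T₂) ^ (j : ℕ), ?_, ?_⟩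
    · refine Subgroup.mul_mem _ (Subgroup.pow_mem _ (Subgroup.subset_closure ?_) _)
        (Subgroup.pow_mem _ (Subgroup.subset_closure ?_) _)
      · simp [hgens]
      · simp [hgens]
    · rw [Prod.snd_mul, Prod.pow_snd, Prod.pow_snd, Equiv.Perm.mul_apply, ht₀]
      simp only
      rw [hT₂, torusSnd_pow_apply, hT₁, torusFst_pow_apply, finRotate_pow_zero m₁ i i.isLt,
        finRotate_pow_zero m₂ j j.isLt]
  exact chain_succ_le_of_transitiveSymmetry d v ε gens hgen t₀ htrans θ p hθ hdom halt

/-- **Torus-symmetric designs satisfy the `K + log² m` law with `C = 2`.** [folklore] -/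
theorem torus_kPlusLogSq (hm₁ : 0 < m₁) (hm₂ : 0 < m₂) (d : Fin K → ℕ)
    (v ε : Fin (m₁ * m₂) → Fin (m₁ * m₂) → Fin K → ℤ)
    (hv₁ : ∀ a b l, v ((finProdFinEquiv.permCongr (Equiv.prodCongr (finRotate m₁) (Equiv.refl (Fin m₂)))) a)
      ((finProdFinEquiv.permCongr (Equiv.prodCongr (finRotate m₁) (Equiv.refl (Fin m₂)))) b) l = v a b l)
    (hε₁ : ∀ a b l, ε ((finProdFinEquiv.permCongr (Equiv.prodCongr (finRotate m₁) (Equiv.refl (Fin m₂)))) a)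
      ((finProdFinEquiv.permCongr (Equiv.prodCongr (finRotate m₁) (Equiv.refl (Fin m₂)))) b) l = ε a b l)
    (hv₂ : ∀ a b l, v ((finProdFinEquiv.permCongr (Equiv.prodCongr (Equiv.refl (Fin m₁)) (finRotate m₂))) a)
      ((finProdFinEquiv.permCongr (Equiv.prodCongr (Equiv.refl (Fin m₁)) (finRotate m₂))) b) l = v a b l)
    (hε₂ : ∀ a b l, ε ((finProdFinEquiv.permCongr (Equiv.prodCongr (Equiv.refl (Fin m₁)) (finRotate m₂))) a)
      ((finProdFinEquiv.permCongr (Equiv.prodCongr (Equiv.refl (Fin m₁)) (finRotate m₂))) b) l = ε a b l)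
    (hε1 : ∀ i j l, (ε i j l).natAbs ≤ 1)
    {n : ℕ} (θ : Fin (n + 1) → ℤ) (p : Fin (n + 1) → Equiv.Perm (Fin (m₁ * m₂)) × (Fin (m₁ * m₂) → Fin K))
    (hθ : StrictMono θ) (hdom : ∀ k, IsDominant d v ε (θ k) (p k))
    (halt : ∀ k : Fin n, termSign ε (p k.castSucc) * termSign ε (p k.succ) < 0) :
    n ≤ 2 ^ (2 * (K + Nat.log 2 (m₁ * m₂) ^ 2)) := by
  classical
  -- same two generators and base point as above
  set T₁ : Equiv.Perm (Fin (m₁ * m₂)) :=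
    finProdFinEquiv.permCongr (Equiv.prodCongr (finRotate m₁) (Equiv.refl (Fin m₂))) with hT₁
  set T₂ : Equiv.Perm (Fin (m₁ * m₂)) :=
    finProdFinEquiv.permCongr (Equiv.prodCongr (Equiv.refl (Fin m₁)) (finRotate m₂)) with hT₂
  set gens : Set (Equiv.Perm (Fin (m₁ * m₂)) × Equiv.Perm (Fin (m₁ * m₂))) := {(T₁, T₁), (T₂, T₂)} with hgens
  have hgen : ∀ g ∈ gens, (∀ a b l, v (g.1 a) (g.2 b) l = v a b l) ∧ (∀ a b l, ε (g.1 a) (g.2 b) l = ε a b l) := by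
    intro g hg
    rcases hg with rfl | hg
    · exact ⟨hv₁, hε₁⟩
    · rw [Set.mem_singleton_iff] at hg
      subst hg
      exact ⟨hv₂, hε₂⟩
  set t₀ : Fin (m₁ * m₂) := finProdFinEquiv (⟨0, hm₁⟩, ⟨0, hm₂⟩) with ht₀
  have htrans : ∀ b : Fin (m₁ * m₂), ∃ g ∈ Subgroup.closure gens, g.2 t₀ = b := by
    intro b
    obtain ⟨⟨i, j⟩, rfl⟩ := finProdFinEquiv.surjective b
    refine ⟨(T₁, T₁) ^ (i : ℕ) * (T₂, T₂) ^ (j : ℕ), ?_, ?_⟩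
    · refine Subgroup.mul_mem _ (Subgroup.pow_mem _ (Subgroup.subset_closure ?_) _)
        (Subgroup.pow_mem _ (Subgroup.subset_closure ?_) _)
      · simp [hgens]
      · simp [hgens]
    · rw [Prod.snd_mul, Prod.pow_snd, Prod.pow_snd, Equiv.Perm.mul_apply, ht₀]
      simp only
      rw [hT₂, torusSnd_pow_apply, hT₁, torusFst_pow_apply, finRotate_pow_zero m₁ i i.isLt,
        finRotate_pow_zero m₂ j j.isLt]
  exact transitiveSymmetry_kPlusLogSq d v ε gens hgen t₀ htrans hε1 θ p hθ hdom halt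

end Torus

end Summit.ValiantsHypothesis.ValiantsHypothesis.Theorems.KPlusLogSqLaw
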